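import Literature.IUT.HodgeTheaters.InitialThetaDataRemarksProofs
import HarnessLib

/-!
# D-0123(C) IUT REPAIR-CATALOGUE (rung LADDER-ABC:A2), proposed row RC-441 (= rcat-lit-1 g3 L1-102): Zhou 2025,
# «2-torsion initial Θ-data» ([IUTchI] Def. 3.1 (b) DATUM-CLASS variant) — the variant's replacement argument for
# [IUTchI] Remark 3.1.5 («K is Galois over F_mod») CHECKED IN THE KERNEL without the 3-torsion clause

Record file (D-0012) of the abc-iut cell, seat abc-iut-rcat-tst-7 (floating tester, NEW rows); PROOF-ONLY (no new
definition, no new hypothesis-as-definition, no instance, no notation). TAKES NO SIDE on [IUTchIII] Cor. 3.12 /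
[IUTchIV] Thm. 1.10, on any author, or on the variant (D-0045); nothing here asserts abc proved or refuted; the variant
is a claim-tagged READING of the literature, never a Literature fact. typed ≠ proved; located ≠ adjudicated.

SOURCE (located by rcat-lit-1 g3, row L1-102): Zhong-Peng Zhou, *The inter-universal Teichmüller theory and new
Diophantine results over the rational numbers. II*, arXiv:2510.05448 (Oct 2025), §2.1 Definition 2.1 (store chunk
p0007 l.1–36) — «2-torsion initial Θ-data»: [IUTchI] Def. 3.1 with clause (b)'s «the 2·3-torsion points of `E_F` are
rational over `F`» replaced by «the 2-torsion points of `E_F` are rational over `F`, and `E_F` has a model over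
`F_mod`», and the printed replacement argument for [IUTchI] Rmk. 3.1.5: «As a consequence of “F(E[3]) = F”, it is
stated that K is Galois over F_mod at the beginning of [IUTchI], Remark 3.1.5. This still holds for its 2-torsion
version. Since E_F has a model E defined over F_mod, we can put L = F_mod(E[l]), then L/F_mod is Galois. Since F/F_mod
is Galois by the definition of [2-torsion] initial Θ-data, we can see that K = F(E_F[l]) = F·L is Galois over F_mod.»
(IUT Summit 2025 deck, paper:url-ff7fed354a15, slides 26–27.)

WHAT THE TREE ALREADY HAS (abc-iut-L5-t2 / L5-t12, `Literature/IUT/HodgeTheaters/`): the REAL typing of [IUTchI]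
Def. 3.1 (`InitialThetaData`, clause (b) = field `torsion_six_rational`), Rmk. 3.1.5 typed as
`InitialThetaData.KGaloisOverFieldOfModuli` (every ring automorphism of `F̄` fixing `F_mod` pointwise carries
`K ⊆ F̄` into itself) and PROVED (`kGaloisOverFieldOfModuli_holds`) by the twist argument of [IUTchIV] Prop. 1.8 (iv)
— the one step that consumes the rational 3-torsion (`apply_conj_torsion_eq_of_fixesTorsion`).

WHAT THIS FILE RECORDS: the SAME conclusion — stated over the bare carriers `F ⊆ K ⊆ F̄`, `E = E_F`, `l`, with exactly
the clauses the variant keeps (`F/F_mod` Galois, Def. 3.1 (b); `K` = the field cut out by the `l`-torsion,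
Def. 3.1 (c), in L5-t2's `range_K_iff` form) and, INSTEAD of any torsion-rationality clause, the variant's added
hypothesis «`E_F` has a model over `F_mod`» written inline as `C₀ • E = E₀.map (algebraMap F_mod F)` for a Weierstrass
equation `E₀` over `F_mod` and a change of variables `C₀` over `F` — is a THEOREM:
* `apply_conj_torsion_eq_of_fixesTorsion_of_model` — for `σ ∈ Aut(F̄)` fixing `F_mod` and `ρ ∈ Gal(F̄/F)` fixing
  `E_F[l]` pointwise, `ρ` fixes the `σ`-conjugates of the coordinates of every `l`-torsion point of `E_F(F̄)`. Proof:
  with a model, the change of variables `C := (σ C₀)⁻¹ C₀` over `F̄` carries `E_{F̄}` to the conjugate equation `E^σ`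
  and has coefficients in `F ∪ σ(F) = F`, so `ρ(C) = C` OUTRIGHT — the 3-torsion rigidity step of the printed
  argument is not needed; the rest is L5-t12's transport verbatim.
* `kGalois_of_model` — hence `σ(K) ⊆ K` for every such `σ`: the body of `InitialThetaData.KGaloisOverFieldOfModuli`
  (which does not read its `InitialThetaData` argument), i.e. the variant's «K = F·L is Galois over F_mod» at the typed
  level. This is the kernel form of ONE item of the variant's printed locus list («F(E[3]) = F is only used in [IUTchI]
  Rmk 3.1.5, [IUTchIV] Thm 1.10 and Cor 2.2 via Prop 1.8 (iv),(v)»); the other items and the print-silent use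
  (split multiplicative reduction of the base curve at `V(F)^bad`, L5-t12 `InitialThetaDataSplitBaseProofs`) are NOT
  addressed here (catalogue sheet HOME/staging/RCAT/tst-7/PREWORD-RC-441-L1-102.md). Standard axioms only.
-/

noncomputable section

open scoped Classical
open WeierstrassCurve

universe u v w

namespace Summit.ABC.IUTFork.Repair.RcatZhou2Torsion

open Literature.NumberTheory.EllipticCurves Literature.IUT.HodgeTheaters

variable {F : Type u} {K : Type v} {Fbar : Type w} [Field F] [NumberField F] [Field K] [NumberField K]
  [Algebra F K] [Field Fbar] [Algebra F Fbar] [Algebra K Fbar] {E : WeierstrassCurve F} [E.IsElliptic] {l : ℕ}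

/-- "`F` is Galois over `F_mod`" (Def. 3.1 (b), KEPT by the variant): a ring automorphism of `F̄` fixing `F_mod`
pointwise carries `F ⊆ F̄` into itself (Mathlib's `AlgHom.restrictNormal`; = L5-t12's
`InitialThetaData.map_F_mem_range_of_fixes_fieldOfModuli` with the Θ-datum replaced by the one instance it uses).
[folklore] -/
theorem map_F_mem_range_of_fixes_fieldOfModuli [IsGalois (fieldOfModuli E) F] (σ : Fbar ≃+* Fbar)
    (hσ : ∀ x : fieldOfModuli E, σ (algebraMap F Fbar (x : F)) = algebraMap F Fbar (x : F)) (a : F) :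
    σ (algebraMap F Fbar a) ∈ Set.range (algebraMap F Fbar) := by
  have hσ' : ∀ x : fieldOfModuli E, σ (algebraMap (fieldOfModuli E) Fbar x) =
      algebraMap (fieldOfModuli E) Fbar x := fun x => by
    rw [IsScalarTower.algebraMap_apply (fieldOfModuli E) F Fbar]
    exact hσ x
  let σ' : Fbar →ₐ[fieldOfModuli E] Fbar := AlgHom.mk (σ : Fbar →+* Fbar) hσ'
  exact ⟨σ'.restrictNormal F a, AlgHom.restrictNormal_commutes σ' F a⟩

/-- **The variant's replacement for the twist step of Rmk. 3.1.5.** If `E_F` has a model `E₀` over `F_mod`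
(`C₀ • E = E₀ ⊗ F` for a change of variables `C₀` over `F`), `σ ∈ Aut(F̄)` fixes `F_mod` pointwise and
`ρ ∈ Gal(F̄/F)` fixes the `l`-torsion of `E_F` pointwise, then `ρ` fixes the `σ`-conjugates of the coordinates of
every `l`-torsion point of `E_F(F̄)` — WITHOUT any torsion-rationality clause: the change of variables
`(σC₀)⁻¹ C₀ : E_{F̄} ⥲ E^σ` has coefficients fixed by `ρ`. (Compare L5-t12's `apply_conj_torsion_eq_of_fixesTorsion`,
which obtains `ρ(C) = C` from the nine rational 3-torsion points instead.) [folklore] -/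
theorem apply_conj_torsion_eq_of_fixesTorsion_of_model [IsGalois (fieldOfModuli E) F]
    (E₀ : WeierstrassCurve (fieldOfModuli E)) (C₀ : VariableChange F)
    (hmodel : C₀ • E = E₀.map (algebraMap (fieldOfModuli E) F)) (σ : Fbar ≃+* Fbar)
    (hσ : ∀ x : fieldOfModuli E, σ (algebraMap F Fbar (x : F)) = algebraMap F Fbar (x : F))
    (ρ : Fbar ≃ₐ[F] Fbar) (hρ : FixesTorsion E l ρ) {x y : Fbar}
    (h : (E.baseChange Fbar).toAffine.Nonsingular x y)
    (hT : (l : ℤ) • (Affine.Point.some x y h : (E.baseChange Fbar).toAffine.Point) = 0) :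
    ρ (σ x) = σ x ∧ ρ (σ y) = σ y := by
  -- the ring homomorphisms underlying `ρ` and `σ`, and `ι : F → F̄`
  obtain ⟨ρr, hρr⟩ : ∃ ρr : Fbar →+* Fbar, ∀ z, ρr z = ρ z :=
    ⟨(ρ : Fbar →ₐ[F] Fbar), fun _ => rfl⟩
  have hσr : ∀ z, (σ : Fbar →+* Fbar) z = σ z := fun _ => rfl
  let ι : F →+* Fbar := algebraMap F Fbar
  have hι : ∀ a, ι a = algebraMap F Fbar a := fun _ => rfl
  -- (1) `F/F_mod` normal: `σ(F) = F`, so `ρ` fixes `F` and `σ(F)` pointwise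
  have hF : ∀ a : F, ∃ a' : F, algebraMap F Fbar a' = σ (algebraMap F Fbar a) := fun a =>
    map_F_mem_range_of_fixes_fieldOfModuli σ hσ a
  have hρι : ∀ a : F, ρr (algebraMap F Fbar a) = algebraMap F Fbar a := fun a => by
    rw [hρr]
    exact ρ.commutes a
  have hρσι : ∀ a : F, ρr (σ (algebraMap F Fbar a)) = σ (algebraMap F Fbar a) := fun a => by
    obtain ⟨a', ha'⟩ := hF a
    rw [← ha', hρι]
  -- (2) the equations `W₁ = E_{F̄}`, `W₂ = E^σ`, and the model `W₀ = E₀ ⊗ F̄`, which `σ` fixes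
  let W₁ : WeierstrassCurve Fbar := E.baseChange Fbar
  have hW₁ : W₁ = E.map ι := rfl
  let W₂ : WeierstrassCurve Fbar := W₁.map (σ : Fbar →+* Fbar)
  have hW₂ : W₂ = W₁.map (σ : Fbar →+* Fbar) := rfl
  let W₀ : WeierstrassCurve Fbar := (E₀.map (algebraMap (fieldOfModuli E) F)).map ι
  have hW₀ : W₀ = (E₀.map (algebraMap (fieldOfModuli E) F)).map ι := rfl
  have hW₀σ : W₀.map (σ : Fbar →+* Fbar) = W₀ := by
    rw [hW₀, WeierstrassCurve.map_map, WeierstrassCurve.map_map]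
    ext <;> simp only [map_a₁, map_a₂, map_a₃, map_a₄, map_a₆, RingHom.coe_comp, Function.comp_apply,
      IntermediateField.algebraMap_apply, hσr, hι] <;> exact hσ _
  -- (3) the change of variables `C := (σC₁)⁻¹ C₁`, `C₁ := C₀ ⊗ F̄`, carries `W₁` to `W₂` …
  let C₁ : VariableChange Fbar := C₀.map ι
  have hC₁_def : C₁ = C₀.map ι := rfl
  have hC₁ : C₁ • W₁ = W₀ := by
    rw [hC₁_def, hW₁, hW₀, WeierstrassCurve.map_variableChange, hmodel]
  let C₁σ : VariableChange Fbar := C₁.map (σ : Fbar →+* Fbar)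
  have hC₁σ_def : C₁σ = C₁.map (σ : Fbar →+* Fbar) := rfl
  have hC₁σ : C₁σ • W₂ = W₀ := by
    have hmv := WeierstrassCurve.map_variableChange W₁ C₁ (σ : Fbar →+* Fbar)
    rw [hC₁, hW₀σ] at hmv
    rw [hC₁σ_def, hW₂]
    exact hmv
  let C : VariableChange Fbar := C₁σ⁻¹ * C₁
  have hC_def : C = C₁σ⁻¹ * C₁ := rfl
  have hC : C • W₁ = W₂ := by
    rw [hC_def, mul_smul, hC₁, ← hC₁σ, inv_smul_smul]
  -- … and is fixed by `ρ` (its coefficients lie in `F` and `σ(F)`)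
  have hρι' : ρr.comp ι = ι := RingHom.ext fun a => hρι a
  have hρσι' : ρr.comp ((σ : Fbar →+* Fbar).comp ι) = (σ : Fbar →+* Fbar).comp ι :=
    RingHom.ext fun a => hρσι a
  have hC₁ρ : C₁.map ρr = C₁ := by
    rw [hC₁_def, VariableChange.map_map, hρι']
  have hC₁σρ : C₁σ.map ρr = C₁σ := by
    rw [hC₁σ_def, hC₁_def]
    simp only [VariableChange.map_map]
    rw [hρσι']
  have hCρC : C.map ρr = C := by
    change VariableChange.mapHom ρr (C₁σ⁻¹ * C₁) = C₁σ⁻¹ * C₁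
    rw [map_mul, map_inv]
    change (C₁σ.map ρr)⁻¹ * C₁.map ρr = C₁σ⁻¹ * C₁
    rw [hC₁σρ, hC₁ρ]
  -- (4) hence `ρ` fixes the coordinates of `e(T)` for every `l`-torsion `T ∈ E(F̄)`, `e := (x ↦ C·x)`
  have keyl : ∀ {a b : Fbar} (hab : W₁.toAffine.Nonsingular a b),
      (l : ℤ) • (Affine.Point.some a b hab : W₁.toAffine.Point) = 0 →
        ρr (C.toX a) = C.toX a ∧ ρr (C.toY a b) = C.toY a b := by
    intro a b hab hlT
    have hfix := hρ (Affine.Point.some a b hab) hlT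
    rw [galoisAct, Affine.Point.map_some, Affine.Point.some.injEq] at hfix
    have ha : ρr a = a := by rw [hρr]; exact hfix.1
    have hb : ρr b = b := by rw [hρr]; exact hfix.2
    constructor
    · rw [map_toX_ringHom, hCρC, ha]
    · rw [map_toY_ringHom, hCρC, ha, hb]
  -- `σ̃ : E(F̄) → E^σ(F̄)` and the given `l`-torsion point: `σ̃ T ∈ E^σ[l] = e(E[l])`
  obtain ⟨f, hf⟩ := exists_pointHom_map W₁ (σ : Fbar →+* Fbar)
  let e : W₁.toAffine.Point ≃+ W₂.toAffine.Point :=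
    (VariableChange.pointEquiv W₁ C).trans (Affine.Point.congrEquiv hC)
  have he : ∀ {a b : Fbar} (hab : W₁.toAffine.Nonsingular a b),
      e (Affine.Point.some a b hab) = Affine.Point.some (C.toX a) (C.toY a b)
        (hC ▸ (VariableChange.nonsingular_iff W₁ C a b).mpr hab) := fun hab => by
    simp only [e, AddEquiv.trans_apply, VariableChange.pointEquiv_some,
      Affine.Point.congrEquiv_some]
  have hQ := hf h
  have hlQ : (l : ℤ) • f (Affine.Point.some x y h) = 0 := by rw [← map_zsmul, hT, map_zero]
  have hlP : (l : ℤ) • e.symm (f (Affine.Point.some x y h)) = 0 := by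
    rw [← map_zsmul, hlQ, map_zero]
  rcases hP : e.symm (f (Affine.Point.some x y h)) with _ | ⟨x', y', h'⟩
  · have h0 : f (Affine.Point.some x y h) = 0 := by
      rw [← e.apply_symm_apply (f _), hP, ← Affine.Point.zero_def, map_zero]
    rw [hQ] at h0
    exact absurd h0 (Affine.Point.some_ne_zero _)
  · rw [hP] at hlP
    obtain ⟨hX, hY⟩ := keyl h' hlP
    have heP : e (Affine.Point.some x' y' h') = f (Affine.Point.some x y h) := by
      rw [← hP, e.apply_symm_apply]
    rw [he, hQ, Affine.Point.some.injEq] at heP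
    rw [← hρr, ← hρr, ← hσr x, ← hσr y, ← heP.1, ← heP.2]
    exact ⟨hX, hY⟩

omit [NumberField K] [Algebra F K] in
/-- **[IUTchI] Rmk. 3.1.5 for the variant's data — «K = F·L is Galois over F_mod», PROVED at the typed level without
the 3-torsion clause.** Over the carriers `F ⊆ K ⊆ F̄` with `F/F_mod` Galois (Def. 3.1 (b), kept), `K` the field cut
out by the `l`-torsion of `E_F` (Def. 3.1 (c), L5-t2's `range_K_iff` form) and a model of `E_F` over `F_mod` (the
variant's added clause), every ring automorphism of `F̄` fixing `F_mod` pointwise carries `K ⊆ F̄` into itself — the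
body of `InitialThetaData.KGaloisOverFieldOfModuli` (abc-iut-L5-t2), with L5-t12's proof of
`kGaloisOverFieldOfModuli_holds` rerun on `apply_conj_torsion_eq_of_fixesTorsion_of_model`. [folklore] -/
theorem kGalois_of_model [IsGalois (fieldOfModuli E) F]
    (hK : ∀ z : Fbar, z ∈ Set.range (algebraMap K Fbar) ↔
      ∀ τ : Fbar ≃ₐ[F] Fbar, FixesTorsion E l τ → τ z = z)
    (E₀ : WeierstrassCurve (fieldOfModuli E)) (C₀ : VariableChange F)
    (hmodel : C₀ • E = E₀.map (algebraMap (fieldOfModuli E) F)) (σ : Fbar ≃+* Fbar)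
    (hσ : ∀ x : fieldOfModuli E, σ (algebraMap F Fbar (x : F)) = algebraMap F Fbar (x : F)) (y : K) :
    σ (algebraMap K Fbar y) ∈ Set.range (algebraMap K Fbar) := by
  have hF : ∀ a : F, ∃ a' : F, algebraMap F Fbar a' = σ (algebraMap F Fbar a) := fun a =>
    map_F_mem_range_of_fixes_fieldOfModuli σ hσ a
  rw [hK]
  intro ρ hρ
  -- `ρ' := σ⁻¹ ∘ ρ ∘ σ` is an `F`-algebra automorphism of `F̄` …
  have hcomm : ∀ a : F, ((σ.trans (ρ : Fbar ≃+* Fbar)).trans σ.symm) (algebraMap F Fbar a) =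
      algebraMap F Fbar a := by
    intro a
    obtain ⟨a', ha'⟩ := hF a
    rw [RingEquiv.trans_apply, RingEquiv.trans_apply, RingEquiv.symm_apply_eq, ← ha']
    exact ρ.commutes a'
  let ρ' : Fbar ≃ₐ[F] Fbar := AlgEquiv.ofRingEquiv hcomm
  -- … fixing `E_F[l]` pointwise
  have hρ' : FixesTorsion E l ρ' := by
    intro T hlT
    rcases T with _ | ⟨x, y, h⟩
    · simp only [← Affine.Point.zero_def, map_zero]
    · obtain ⟨hx, hy⟩ :=
        apply_conj_torsion_eq_of_fixesTorsion_of_model E₀ C₀ hmodel σ hσ ρ hρ h hlT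
      rw [galoisAct, Affine.Point.map_some]
      simp only [Affine.Point.some.injEq]
      constructor
      · change σ.symm (ρ (σ x)) = x
        rw [hx, RingEquiv.symm_apply_apply]
      · change σ.symm (ρ (σ y)) = y
        rw [hy, RingEquiv.symm_apply_apply]
  have hfixK := (hK (algebraMap K Fbar y)).mp ⟨y, rfl⟩ ρ' hρ'
  change σ.symm (ρ (σ (algebraMap K Fbar y))) = algebraMap K Fbar y at hfixK
  rw [RingEquiv.symm_apply_eq] at hfixK
  exact hfixK

/-- **Corollary on L5-t2's Θ-data interface**: for any `D : InitialThetaData F K F̄ E l P` that ALSO carries a model of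
`E_F` over `F_mod`, `D.KGaloisOverFieldOfModuli` follows from `kGalois_of_model` through `D.range_K_iff` and
`D.isGalois_fieldOfModuli` alone — `D.torsion_six_rational` is not read (this restates nothing new about print's data,
which satisfy the 3-torsion clause anyway; it records that the variant's route lands on the SAME typed statement).
[folklore] -/
theorem kGaloisOverFieldOfModuli_of_model {P : BadPlacePredicates K} (D : InitialThetaData F K Fbar E l P)
    (E₀ : WeierstrassCurve (fieldOfModuli E)) (C₀ : VariableChange F)
    (hmodel : C₀ • E = E₀.map (algebraMap (fieldOfModuli E) F)) : D.KGaloisOverFieldOfModuli := by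
  haveI := D.isGalois_fieldOfModuli
  intro σ hσ y
  exact kGalois_of_model D.range_K_iff E₀ C₀ hmodel σ hσ y

end Summit.ABC.IUTFork.Repair.RcatZhou2Torsion

end
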